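import Summits.QuantumFields.YangMills.Theorems.UnitScaleTiltProp7PinnedSliceOfLinCorrRow
import Summits.QuantumFields.YangMills.Theorems.UnitScaleTiltProp7PinnedSliceOfUntwistedStart
import Literature.MathematicalPhysics.QuantumFieldTheory.Balaban1983to89.T3Thm1CarrierNative
import HarnessLib

/-!
# Route `UnitScaleTilt`, crux K1 «MinimiserStabilityRegPr» (stmt-QuantumFields-19200), route-R E′ path (α′): THE (E1)-DOOR KNIT — the (E1) conjunct «PINNED SLICE THEOREM»
# of the E′ display ✓ `Prop7PV3EOfPinnedSliceAndRawRowsAbs.stub_PV3E_of_pinnedSliceAndRawRows_abs` (its `hrows` conjunct, VERBATIM, per `L`) FROM THREE DISPLAYED SOCKETS: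
# (a) the Thm-2 datum per member∕competitor (`W′ = (e^{iA₀}W)^u` with print's rows (1.36)₁₂, (1.72) and the (3.35) frames — ✓ `exists_untwistedStart_En_T3`'s hypotheses
# VERBATIM, existentially packaged), (b) the (E1-b) gauge-row socket `hLrow` of ✓ `Prop7PinnedSliceOfLinCorrRow` per member, (c) L-only constants and windows with
# `sQ = 2s + 9Cs` STATED AS AN EQUALITY; the torus potential is supplied inside

Cell `ym3-torus`, width seat `ym3-torus-px13` (gen 4); ★ym-ust-19200-p1 g16 NAMER WORD 16 (1) «px13: (E1)-DOOR KNIT GO» (2026-08-29 00:19Z), with (b) := the socket of record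
`hLrow` (px13 g3 SOCKET NOTE, ✓p682239).  THEOREMS ONLY (0 `def`, 0 `sorry`, 0 `instance`); `--supports stmt-QuantumFields-19200`, count-neutral.  YM₃ on T³ is a ladder rung
(R3), not the Clay problem; nothing here claims the stub, the crux, d = 4 or the gap; (E1) is NOT closed by this file — its three sockets are DISPLAYED, each with a named
supplier (Thm-2 datum: the EX∕[B-RegSp] Thm 2 lineage, w1 g12; `hLrow`: ★routeR-w3's (E1-b) close re-exported with (I) and solvability; windows: the assembler ★p1).

WHAT IS PROVED (ns `…Theorems.Prop7PinnedSliceRowOfThm2Datum`; `ℓ := (F.L : ℝ)^(K−n)`, `𝒰 := fun κ z => unitsField (toUField W) ⟨z, κ⟩`).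
* `forty_mul_le_pow` — `40·s ≤ L ⇒ 40·s ≤ L^{K−n}` for `K − n ≥ 1`, `L ≥ 1` (the door's `hs40` is L-only).
* ★★★ `pinnedSliceRow_of_thm2Datum` — FOR EVERY `L` and L-only reals `e₆ sQ s C s₀ s₁′ σ c₀ c₁` with `0 ≤ C`, print's windows `s₀ ≤ 1∕64`, `σ ≤ 1∕1024`,
  `(6 + 2c₀)(2σ) ≤ 1∕256`, `S₁(s₀,σ,c₀) ≤ s`, `S₂(s₁′,σ,c₀,c₁; d = 3) ≤ s` (w1's two printed chart constants), `40s ≤ L`, `1800·C·s ≤ 1`, `(3C∕2)·1600·(7(3C∕2)s + s) ≤ 1∕2`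
  and `sQ = 2s + 9Cs`: (a) ∧ (b) ⟹ **the (E1) conjunct of ✓p680452's `hrows` BYTE-VERBATIM** (`∀ F, F.L = L → ∀ n K hnK e V W, 0 < e → e ≤ e₆ → W ∈ (6)(e) ∩ 𝔅_k(V) →
  IsCritR2 → ∀ W′ ∈ (6)(e) ∩ 𝔅_k(V), ∃ Y ∈ (6)(e) ∩ 𝔅_k(V), A(W′) = A(Y) ∧ ‖↑(Y_bW_b⁻¹) − 1‖ ≤ sQ·ℓ⁻¹ ∧ S_H off the centres`).
  PROOF.  `intro`; the datum gives `A₀ u Fr a₀ a₁` with `W′ = (e^{iA₀}W)^u`; `subst`; ✓ `pinnedSlice_of_untwistedStart_of_linCorrRow` at the member's `hLrow`.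
* ★★ `pinnedSliceRow_of_thm2Datum_hK` — the same door over the corrector rows (hK),(hK₂) displayed for EVERY characterised `(I, L)` and EVERY torus-potential letter `d` with its
  descent row (✓ `pinnedSlice_of_untwistedStart`'s `hKrows`, quantified over `d`), `C_L := max (3cI∕2) (max cI c₂)`, windows `1200·C_L·s ≤ 1`, `C_L·1600·(7C_L s + s) ≤ 1∕2`,
  `sQ = 2s + 6·C_L·s` (WORD 16 (b) as first lettered); the torus potential ✓ `exists_torusPotential` is chosen inside.
HONEST SCOPE.  Door algebra (quantifier plumbing); no analytic estimate is proved here; every analytic row is one of the three displayed sockets.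

References: T. Bałaban, CMP 102 (1985) 277–309 [Balaban1985Variational] (Prop. 7 p.299, (4)–(7) p.278, (141)–(143) p.299); CMP 99 (1985) 75–102 [Balaban1985RegularSpaces]
((1.29)–(1.30) p.81, (1.36) p.82, Thm 2 p.83, (1.72) p.88); CMP 99 (1985) 389–434 [Balaban1985BackgroundPropagators] ((3.3) p.390, (3.8) p.392, (3.35) p.396); CMP 98 (1985)
17–51 [Balaban1985Averaging] ((21)–(23) p.21).
-/

set_option autoImplicit false

noncomputable section

open scoped BigOperators Matrix.Norms.L2Operator Matrix
open NormedSpace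

namespace Summit.QuantumFields.YangMills.Theorems.Prop7PinnedSliceRowOfThm2Datum

open Literature.MathematicalPhysics.QuantumFieldTheory.Balaban1983to89
open Literature.MathematicalPhysics.QuantumFieldTheory.Balaban1983to89.T3ContinuumYM3Torus
open Literature.MathematicalPhysics.QuantumFieldTheory.Balaban1983to89.T3PrintedRegularMinimiser (regFibrePr)
open Literature.MathematicalPhysics.QuantumFieldTheory.Balaban1983to89.T3SectALandauChart (emb15)
open Literature.MathematicalPhysics.QuantumFieldTheory.Balaban1983to89.T3Thm1CarrierNative (IsCritR2)
open T4Continuum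
open MatrixLog (mlog)
open B9Eq39Adjoint (covD divB)
open B9TorusCalculus (torusT)
open B15DeterminingSets (embIter)
open B10Eq27TorusAxialLog (unitsField toUField)
open B5Eq118OneStroke (iterBlockOf)
open Summit.QuantumFields.YangMills.Theorems.Prop7TPrint (expHermField)
open Summit.QuantumFields.YangMills.Theorems.Prop7ExactCorrectorHNMember (exists_torusPotential)
open Summit.QuantumFields.YangMills.Theorems.Prop7PinnedSliceOfLinCorrRow (pinnedSlice_of_untwistedStart_of_linCorrRow)
open Summit.QuantumFields.YangMills.Theorems.Prop7PinnedSliceOfUntwistedStart (pinnedSlice_of_untwistedStart)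

/-- `40·s ≤ L` and `1 ≤ L`, `1 ≤ k` give `40·s ≤ L^k` (the door's chart-size window is L-only). [folklore] -/
theorem forty_mul_le_pow {L : ℕ} (hL : 1 ≤ L) {k : ℕ} (hk : 1 ≤ k) {s : ℝ} (hs : 40 * s ≤ (L : ℝ)) : 40 * s ≤ (L : ℝ) ^ k := by
  have h1 : (1 : ℝ) ≤ (L : ℝ) := by exact_mod_cast hL
  calc 40 * s ≤ (L : ℝ) := hs
    _ = (L : ℝ) ^ 1 := (pow_one _).symm
    _ ≤ (L : ℝ) ^ k := pow_le_pow_right₀ h1 hk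

/-- ★★★ **THE (E1)-DOOR KNIT** — the (E1) conjunct of ✓ `stub_PV3E_of_pinnedSliceAndRawRows_abs`'s `hrows` (VERBATIM) from (a) the Thm-2 datum socket per member∕competitor
(✓ `exists_untwistedStart_En_T3`'s hypotheses, packaged), (b) the (E1-b) gauge-row socket `hLrow` per member (✓ `pinnedSlice_member_of_linCorrRow`'s binder), (c) L-only
constants∕windows with `sQ = 2s + 9Cs`.
[cite: Balaban1985Variational, Prop. 7 p.299, (141)-(143) p.299; Balaban1985RegularSpaces, Thm 2 p.83, (1.36) p.82, (1.72) p.88; Balaban1985BackgroundPropagators, (3.3) p.390, (3.8) p.392, (3.35) p.396] -/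
theorem pinnedSliceRow_of_thm2Datum (L : ℕ) {e₆ sQ s C s₀ s₁' σ c₀ c₁ : ℝ} (hC : 0 ≤ C)
    -- (c) print's windows on the datum constants, the chart size `s` dominating w1's `S₁`, `S₂` (d = 3), the knit's windows, and `sQ` AS AN EQUALITY
    (hs₀' : s₀ ≤ 1 / 64) (hσ0 : σ ≤ 1 / 1024) (hσc : ((6 + 2 * c₀) * (2 * σ)) ≤ 1 / 256)
    (hS₁ : (s₀ + (1 + 2 * s₀) * ((1 + 6 * σ) * ((6 + 2 * c₀) * (2 * σ)))) ≤ s)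
    (hS₂ : (s₁' + (3 : ℝ) * (((2 * (c₁ + 2 * c₀ ^ 2) + 24 * c₀ + 24) * (2 * σ)) + 9 * ((6 + 2 * c₀) * (2 * σ)) ^ 2 + 36 * σ * ((2 * (c₁ + 2 * c₀ ^ 2) + 24 * c₀ + 24) * (2 * σ))) + (3 : ℝ) * (6 * ((6 + 2 * c₀) * (2 * σ)) * s₀ + 4 * s₀ * ((1 + 6 * σ) * ((6 + 2 * c₀) * (2 * σ))))) ≤ s)
    (hs40 : 40 * s ≤ (L : ℝ))
    (hwin1 : 1800 * C * s ≤ 1) (hwin2 : 3 / 2 * C * (400 * (1 + 3)) * (7 * (3 / 2 * C) * s + s) ≤ 1 / 2)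
    (hsQ : sQ = 2 * s + 9 * C * s)
    -- (a) THE THM-2 DATUM SOCKET per member∕competitor (✓ `exists_untwistedStart_En_T3`'s hypotheses VERBATIM, packaged existentially)
    (hDatum :
    ∀ (F : T3Family), F.L = L → ∀ (n K : ℕ) (hnK : n < K) (e : ℝ) (V : GaugeField (F.P n) 0 (Matrix.specialUnitaryGroup (Fin 2) ℂ))
      (W : GaugeField (F.P K) 0 (Matrix.specialUnitaryGroup (Fin 2) ℂ)),
      0 < e → e ≤ e₆ → W ∈ regFibrePr F n K hnK.le e V → IsCritR2 F n K hnK.le V W →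
      ∀ W' : GaugeField (F.P K) 0 (Matrix.specialUnitaryGroup (Fin 2) ℂ), W' ∈ regFibrePr F n K hnK.le e V →
      ∃ (A₀ : PBond (F.P K) 0 → Matrix (Fin 2) (Fin 2) ℂ) (u : GaugeTransf (F.P K) 0 (Matrix.specialUnitaryGroup (Fin 2) ℂ))
        (Fr : Site (F.P K) (K - n) → Site (F.P K) 0 → (Matrix (Fin 2) (Fin 2) ℂ)ˣ) (a₀ a₁ : ℝ),
        -- the competitor IS print's twisted Landau representative ([Balaban1985RegularSpaces] Thm 2, (1.29)–(1.30))
        W' = GaugeField.gaugeAct u (emb15 W (expHermField A₀)) ∧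
        -- (1.36)₁₂: the Landau datum, Hermitian-traceless, `ℓ‖A₀‖ ≤ s₀`, `ℓ²‖D*_𝒰A₀‖ ≤ s₁′`
        (∀ b, (A₀ b).IsHermitian ∧ Matrix.trace (A₀ b) = 0) ∧
        ((((F.P K).L ^ (K - n) : ℕ)) : ℝ) * ‖(fun (μ : Fin (F.P K).d) (z : Site (F.P K) 0) => A₀ ⟨z, μ⟩)‖ ≤ s₀ ∧
        ((((F.P K).L ^ (K - n) : ℕ)) : ℝ) ^ 2 * ‖(fun x => divB (torusT (F.P K) 0) (fun κ z => unitsField (toUField W) ⟨z, κ⟩) (fun μ z => A₀ ⟨z, μ⟩) x)‖ ≤ s₁' ∧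
        -- (1.72): the twist's centre values
        (∀ y : Site (F.P K) (K - n), dist1 (u (embIter (K - n) y)) ≤ σ) ∧
        -- the (3.35)-type unit frames with their block rows `a₀ a₁` (`ℓa₀ ≤ c₀`, `ℓ²a₁ ≤ c₁`)
        (∀ y z, ‖(Fr y z : Matrix (Fin 2) (Fin 2) ℂ)‖ ≤ 1 ∧ ‖(((Fr y z)⁻¹ : (Matrix (Fin 2) (Fin 2) ℂ)ˣ) : Matrix (Fin 2) (Fin 2) ℂ)‖ ≤ 1) ∧
        (∀ y, Fr y (embIter (K - n) y) = 1) ∧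
        0 ≤ a₀ ∧ 0 ≤ a₁ ∧ ((((F.P K).L ^ (K - n) : ℕ)) : ℝ) * a₀ ≤ c₀ ∧ ((((F.P K).L ^ (K - n) : ℕ)) : ℝ) ^ 2 * a₁ ≤ c₁ ∧
        (∀ (y : Site (F.P K) (K - n)) (z : Site (F.P K) 0), (∀ ν : Fin (F.P K).d, (y ν = (iterBlockOf (K - n) (fun κ => z κ - (((((F.P K).L ^ (K - n) - 1) / 2 : ℕ)) : ZMod ((F.P K).sitesPerDir 0)))) ν - 1 ∨ y ν = (iterBlockOf (K - n) (fun κ => z κ - (((((F.P K).L ^ (K - n) - 1) / 2 : ℕ)) : ZMod ((F.P K).sitesPerDir 0)))) ν ∨ y ν = (iterBlockOf (K - n) (fun κ => z κ - (((((F.P K).L ^ (K - n) - 1) / 2 : ℕ)) : ZMod ((F.P K).sitesPerDir 0)))) ν + 1 ∨ y ν = (iterBlockOf (K - n) (fun κ => z κ - (((((F.P K).L ^ (K - n) - 1) / 2 : ℕ)) : ZMod ((F.P K).sitesPerDir 0)))) ν + 2)) → ∀ μ : Fin (F.P K).d,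
        ‖(((Fr y z)⁻¹ * unitsField (toUField W) ⟨z, μ⟩ * Fr y (torusT (F.P K) 0 μ z) : (Matrix (Fin 2) (Fin 2) ℂ)ˣ) : Matrix (Fin 2) (Fin 2) ℂ) - 1‖ ≤ a₀
        ∧ ‖(((Fr y ((torusT (F.P K) 0 μ).symm z))⁻¹ * unitsField (toUField W) ⟨(torusT (F.P K) 0 μ).symm z, μ⟩ * Fr y z : (Matrix (Fin 2) (Fin 2) ℂ)ˣ) : Matrix (Fin 2) (Fin 2) ℂ) - 1‖ ≤ a₀
        ∧ ‖(((Fr y z)⁻¹ * unitsField (toUField W) ⟨z, μ⟩ * Fr y (torusT (F.P K) 0 μ z) : (Matrix (Fin 2) (Fin 2) ℂ)ˣ) : Matrix (Fin 2) (Fin 2) ℂ)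
        - (((Fr y ((torusT (F.P K) 0 μ).symm z))⁻¹ * unitsField (toUField W) ⟨(torusT (F.P K) 0 μ).symm z, μ⟩ * Fr y z : (Matrix (Fin 2) (Fin 2) ℂ)ˣ) : Matrix (Fin 2) (Fin 2) ℂ)‖ ≤ a₁))
    -- (b) THE (E1-b) GAUGE-ROW SOCKET per member (✓ `pinnedSlice_member_of_linCorrRow`'s `hLrow` VERBATIM)
    (hLrow :
    ∀ (F : T3Family), F.L = L → ∀ (n K : ℕ) (hnK : n < K) (e : ℝ) (V : GaugeField (F.P n) 0 (Matrix.specialUnitaryGroup (Fin 2) ℂ))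
      (W : GaugeField (F.P K) 0 (Matrix.specialUnitaryGroup (Fin 2) ℂ)),
      0 < e → e ≤ e₆ → W ∈ regFibrePr F n K hnK.le e V → IsCritR2 F n K hnK.le V W →
      ∀ (w : Site (F.P K) 0 → ℝ), (∀ (x : Site (F.P K) 0) (y : Site (F.P K) (K - n)), w x ≤ (Site.tdist x (embIter (K - n) y) : ℝ)) →
          (∀ x, w x ≤ (F.L : ℝ) ^ (K - n)) → (∀ x, 0 ≤ w x) →
        ∃ (I : (Site (F.P K) 0 → Matrix (Fin 2) (Fin 2) ℂ) →+ (Site (F.P K) 0 → Matrix (Fin 2) (Fin 2) ℂ))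
          (L : (Fin (F.P K).d → Site (F.P K) 0 → Matrix (Fin 2) (Fin 2) ℂ) →+ (Site (F.P K) 0 → Matrix (Fin 2) (Fin 2) ℂ)),
          -- (I) the pinned `Δ_W`-biharmonic interpolant, characterised
          (∀ φ, ((∀ y : Site (F.P K) (K - n), I φ (embIter (K - n) y) = φ (embIter (K - n) y)) ∧
              ∀ x : Site (F.P K) 0, x ∉ Set.range (embIter (K - n)) →
                divB (torusT (F.P K) 0) (fun κ z => unitsField (toUField W) ⟨z, κ⟩)
                  (fun μ => covD (torusT (F.P K) 0) (fun κ z => unitsField (toUField W) ⟨z, κ⟩) μ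
                    (fun y => divB (torusT (F.P K) 0) (fun κ z => unitsField (toUField W) ⟨z, κ⟩)
                      (fun ν => covD (torusT (F.P K) 0) (fun κ z => unitsField (toUField W) ⟨z, κ⟩) ν (I φ)) y)) x = 0) ∧
            ∀ χ, (∀ y : Site (F.P K) (K - n), χ (embIter (K - n) y) = φ (embIter (K - n) y)) →
              (∀ x : Site (F.P K) 0, x ∉ Set.range (embIter (K - n)) →
                divB (torusT (F.P K) 0) (fun κ z => unitsField (toUField W) ⟨z, κ⟩)
                  (fun μ => covD (torusT (F.P K) 0) (fun κ z => unitsField (toUField W) ⟨z, κ⟩) μ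
                    (fun y => divB (torusT (F.P K) 0) (fun κ z => unitsField (toUField W) ⟨z, κ⟩)
                      (fun ν => covD (torusT (F.P K) 0) (fun κ z => unitsField (toUField W) ⟨z, κ⟩) ν χ) y)) x = 0) → χ = I φ) ∧
          -- (L) the corrector for every potential
          (∀ A φ, (∀ x, divB (torusT (F.P K) 0) (fun κ z => unitsField (toUField W) ⟨z, κ⟩)
                (fun μ => covD (torusT (F.P K) 0) (fun κ z => unitsField (toUField W) ⟨z, κ⟩) μ φ) x
              = divB (torusT (F.P K) 0) (fun κ z => unitsField (toUField W) ⟨z, κ⟩) A x) → L A = φ - I φ) ∧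
          -- pinning
          (∀ (A) (y : Site (F.P K) (K - n)), L A (embIter (K - n) y) = 0) ∧
          -- solvability
          (∀ A, ∃ φ, (∀ x, divB (torusT (F.P K) 0) (fun κ z => unitsField (toUField W) ⟨z, κ⟩)
                (fun μ => covD (torusT (F.P K) 0) (fun κ z => unitsField (toUField W) ⟨z, κ⟩) μ φ) x
              = divB (torusT (F.P K) 0) (fun κ z => unitsField (toUField W) ⟨z, κ⟩) A x) ∧ L A = φ - I φ) ∧
          ∀ A, max ‖L A‖ (max ((F.L : ℝ) ^ (K - n) * ‖(fun μ z => covD (torusT (F.P K) 0) (fun κ z => unitsField (toUField W) ⟨z, κ⟩) μ (L A) z)‖)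
              ((F.L : ℝ) ^ (K - n) * ‖(fun x => ((w x : ℝ) : ℂ) • divB (torusT (F.P K) 0) (fun κ z => unitsField (toUField W) ⟨z, κ⟩)
                (fun μ => covD (torusT (F.P K) 0) (fun κ z => unitsField (toUField W) ⟨z, κ⟩) μ (L A)) x)‖))
            ≤ C * (((F.L : ℝ) ^ (K - n)) ^ 2 * ‖(fun x => divB (torusT (F.P K) 0) (fun κ z => unitsField (toUField W) ⟨z, κ⟩) A x)‖)) :
    (∀ (F : T3Family), F.L = L → ∀ (n K : ℕ) (hnK : n < K) (e : ℝ) (V : GaugeField (F.P n) 0 (Matrix.specialUnitaryGroup (Fin 2) ℂ))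
      (W : GaugeField (F.P K) 0 (Matrix.specialUnitaryGroup (Fin 2) ℂ)),
      0 < e → e ≤ e₆ → W ∈ regFibrePr F n K hnK.le e V → IsCritR2 F n K hnK.le V W →
      ∀ W' : GaugeField (F.P K) 0 (Matrix.specialUnitaryGroup (Fin 2) ℂ), W' ∈ regFibrePr F n K hnK.le e V →
        ∃ Y : GaugeField (F.P K) 0 (Matrix.specialUnitaryGroup (Fin 2) ℂ), Y ∈ regFibrePr F n K hnK.le e V ∧ wilsonAction4 W' = wilsonAction4 Y ∧
          (∀ b : PBond (F.P K) 0, ‖((Y b * (W b)⁻¹ : Matrix.specialUnitaryGroup (Fin 2) ℂ) : Matrix (Fin 2) (Fin 2) ℂ) - 1‖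
            ≤ sQ * ((F.L : ℝ) ^ (K - n))⁻¹) ∧
          (∀ x : Site (F.P K) 0, x ∉ Set.range (embIter (K - n)) →
            divB (torusT (F.P K) 0) (fun κ z => unitsField (toUField W) ⟨z, κ⟩)
              (fun μ z => covD (torusT (F.P K) 0) (fun κ z => unitsField (toUField W) ⟨z, κ⟩) μ
                (fun y => divB (torusT (F.P K) 0) (fun κ z => unitsField (toUField W) ⟨z, κ⟩)
                  (fun κ z => Complex.I • ((-Complex.I) • mlog ((Y ⟨z, κ⟩ * (W ⟨z, κ⟩)⁻¹ : Matrix.specialUnitaryGroup (Fin 2) ℂ) : Matrix (Fin 2) (Fin 2) ℂ))) y) z) x = 0)) := by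
  intro F hF n K hnK e V W he hee hW hcrit W' hW'
  obtain ⟨A₀, u, Fr, a₀, a₁, hW'eq, hA0, hs₀, hs₁, hσ, hFr, hFr1, ha₀, ha₁, hc₀, hc₁, hA⟩ :=
    hDatum F hF n K hnK e V W he hee hW hcrit W' hW'
  subst hW'eq
  subst hsQ
  have hk1 : 1 ≤ K - n := by omega
  have hs40' : 40 * s ≤ (F.L : ℝ) ^ (K - n) := by
    rw [hF]
    exact forty_mul_le_pow (le_of_lt (hF ▸ F.hL.2)) hk1 hs40
  have hd : ((F.P K).d : ℝ) = 3 := by rw [T3Family.P_d]; norm_num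
  have hS₂' : (s₁' + ((F.P K).d : ℝ) * (((2 * (c₁ + 2 * c₀ ^ 2) + 24 * c₀ + 24) * (2 * σ)) + 9 * ((6 + 2 * c₀) * (2 * σ)) ^ 2 + 36 * σ * ((2 * (c₁ + 2 * c₀ ^ 2) + 24 * c₀ + 24) * (2 * σ))) + ((F.P K).d : ℝ) * (6 * ((6 + 2 * c₀) * (2 * σ)) * s₀ + 4 * s₀ * ((1 + 6 * σ) * ((6 + 2 * c₀) * (2 * σ))))) ≤ s := by
    rw [hd]; exact hS₂
  exact pinnedSlice_of_untwistedStart_of_linCorrRow F hnK.le hk1 he.le W A₀ hA0 hs₀ hs₀' hs₁ u hW' hσ hσ0 hσc Fr hFr hFr1 ha₀ ha₁ hc₀ hc₁ hA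
    hC (hLrow F hF n K hnK e V W he hee hW hcrit) hS₁ hS₂' hs40' hwin1 hwin2

/-- ★★ **THE (E1)-DOOR KNIT OVER THE CORRECTOR ROWS (hK),(hK₂)** — the same door with socket (b) := ✓ `pinnedSlice_of_untwistedStart`'s `hKrows`, displayed for every
torus-potential letter `d` with its descent row (the potential ✓ `exists_torusPotential` is chosen inside); `C_L := max (3cI∕2) (max cI c₂)`, `sQ = 2s + 6·C_L·s`.
[cite: Balaban1985Variational, Prop. 7 p.299, (4)-(7) p.278; Balaban1985RegularSpaces, Thm 2 p.83, (1.36) p.82, (1.72) p.88; Balaban1985Averaging, (21)-(23) p.21] -/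
theorem pinnedSliceRow_of_thm2Datum_hK (L : ℕ) {e₆ sQ s cI c₂ s₀ s₁' σ c₀ c₁ : ℝ} (hcI : 0 ≤ cI) (hc₂ : 0 ≤ c₂)
    (hs₀' : s₀ ≤ 1 / 64) (hσ0 : σ ≤ 1 / 1024) (hσc : ((6 + 2 * c₀) * (2 * σ)) ≤ 1 / 256)
    (hS₁ : (s₀ + (1 + 2 * s₀) * ((1 + 6 * σ) * ((6 + 2 * c₀) * (2 * σ)))) ≤ s)
    (hS₂ : (s₁' + (3 : ℝ) * (((2 * (c₁ + 2 * c₀ ^ 2) + 24 * c₀ + 24) * (2 * σ)) + 9 * ((6 + 2 * c₀) * (2 * σ)) ^ 2 + 36 * σ * ((2 * (c₁ + 2 * c₀ ^ 2) + 24 * c₀ + 24) * (2 * σ))) + (3 : ℝ) * (6 * ((6 + 2 * c₀) * (2 * σ)) * s₀ + 4 * s₀ * ((1 + 6 * σ) * ((6 + 2 * c₀) * (2 * σ))))) ≤ s)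
    (hs40 : 40 * s ≤ (L : ℝ))
    (hwin1 : 1200 * max (3 / 2 * cI) (max cI c₂) * s ≤ 1)
    (hwin2 : max (3 / 2 * cI) (max cI c₂) * (400 * (1 + 3)) * (7 * max (3 / 2 * cI) (max cI c₂) * s + s) ≤ 1 / 2)
    (hsQ : sQ = 2 * s + 6 * max (3 / 2 * cI) (max cI c₂) * s)
    -- (a) THE THM-2 DATUM SOCKET per member∕competitor
    (hDatum :
    ∀ (F : T3Family), F.L = L → ∀ (n K : ℕ) (hnK : n < K) (e : ℝ) (V : GaugeField (F.P n) 0 (Matrix.specialUnitaryGroup (Fin 2) ℂ))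
      (W : GaugeField (F.P K) 0 (Matrix.specialUnitaryGroup (Fin 2) ℂ)),
      0 < e → e ≤ e₆ → W ∈ regFibrePr F n K hnK.le e V → IsCritR2 F n K hnK.le V W →
      ∀ W' : GaugeField (F.P K) 0 (Matrix.specialUnitaryGroup (Fin 2) ℂ), W' ∈ regFibrePr F n K hnK.le e V →
      ∃ (A₀ : PBond (F.P K) 0 → Matrix (Fin 2) (Fin 2) ℂ) (u : GaugeTransf (F.P K) 0 (Matrix.specialUnitaryGroup (Fin 2) ℂ))
        (Fr : Site (F.P K) (K - n) → Site (F.P K) 0 → (Matrix (Fin 2) (Fin 2) ℂ)ˣ) (a₀ a₁ : ℝ),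
        -- the competitor IS print's twisted Landau representative ([Balaban1985RegularSpaces] Thm 2, (1.29)–(1.30))
        W' = GaugeField.gaugeAct u (emb15 W (expHermField A₀)) ∧
        -- (1.36)₁₂: the Landau datum, Hermitian-traceless, `ℓ‖A₀‖ ≤ s₀`, `ℓ²‖D*_𝒰A₀‖ ≤ s₁′`
        (∀ b, (A₀ b).IsHermitian ∧ Matrix.trace (A₀ b) = 0) ∧
        ((((F.P K).L ^ (K - n) : ℕ)) : ℝ) * ‖(fun (μ : Fin (F.P K).d) (z : Site (F.P K) 0) => A₀ ⟨z, μ⟩)‖ ≤ s₀ ∧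
        ((((F.P K).L ^ (K - n) : ℕ)) : ℝ) ^ 2 * ‖(fun x => divB (torusT (F.P K) 0) (fun κ z => unitsField (toUField W) ⟨z, κ⟩) (fun μ z => A₀ ⟨z, μ⟩) x)‖ ≤ s₁' ∧
        -- (1.72): the twist's centre values
        (∀ y : Site (F.P K) (K - n), dist1 (u (embIter (K - n) y)) ≤ σ) ∧
        -- the (3.35)-type unit frames with their block rows `a₀ a₁` (`ℓa₀ ≤ c₀`, `ℓ²a₁ ≤ c₁`)
        (∀ y z, ‖(Fr y z : Matrix (Fin 2) (Fin 2) ℂ)‖ ≤ 1 ∧ ‖(((Fr y z)⁻¹ : (Matrix (Fin 2) (Fin 2) ℂ)ˣ) : Matrix (Fin 2) (Fin 2) ℂ)‖ ≤ 1) ∧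
        (∀ y, Fr y (embIter (K - n) y) = 1) ∧
        0 ≤ a₀ ∧ 0 ≤ a₁ ∧ ((((F.P K).L ^ (K - n) : ℕ)) : ℝ) * a₀ ≤ c₀ ∧ ((((F.P K).L ^ (K - n) : ℕ)) : ℝ) ^ 2 * a₁ ≤ c₁ ∧
        (∀ (y : Site (F.P K) (K - n)) (z : Site (F.P K) 0), (∀ ν : Fin (F.P K).d, (y ν = (iterBlockOf (K - n) (fun κ => z κ - (((((F.P K).L ^ (K - n) - 1) / 2 : ℕ)) : ZMod ((F.P K).sitesPerDir 0)))) ν - 1 ∨ y ν = (iterBlockOf (K - n) (fun κ => z κ - (((((F.P K).L ^ (K - n) - 1) / 2 : ℕ)) : ZMod ((F.P K).sitesPerDir 0)))) ν ∨ y ν = (iterBlockOf (K - n) (fun κ => z κ - (((((F.P K).L ^ (K - n) - 1) / 2 : ℕ)) : ZMod ((F.P K).sitesPerDir 0)))) ν + 1 ∨ y ν = (iterBlockOf (K - n) (fun κ => z κ - (((((F.P K).L ^ (K - n) - 1) / 2 : ℕ)) : ZMod ((F.P K).sitesPerDir 0)))) ν + 2)) → ∀ μ : Fin (F.P K).d,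
        ‖(((Fr y z)⁻¹ * unitsField (toUField W) ⟨z, μ⟩ * Fr y (torusT (F.P K) 0 μ z) : (Matrix (Fin 2) (Fin 2) ℂ)ˣ) : Matrix (Fin 2) (Fin 2) ℂ) - 1‖ ≤ a₀
        ∧ ‖(((Fr y ((torusT (F.P K) 0 μ).symm z))⁻¹ * unitsField (toUField W) ⟨(torusT (F.P K) 0 μ).symm z, μ⟩ * Fr y z : (Matrix (Fin 2) (Fin 2) ℂ)ˣ) : Matrix (Fin 2) (Fin 2) ℂ) - 1‖ ≤ a₀
        ∧ ‖(((Fr y z)⁻¹ * unitsField (toUField W) ⟨z, μ⟩ * Fr y (torusT (F.P K) 0 μ z) : (Matrix (Fin 2) (Fin 2) ℂ)ˣ) : Matrix (Fin 2) (Fin 2) ℂ)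
        - (((Fr y ((torusT (F.P K) 0 μ).symm z))⁻¹ * unitsField (toUField W) ⟨(torusT (F.P K) 0 μ).symm z, μ⟩ * Fr y z : (Matrix (Fin 2) (Fin 2) ℂ)ˣ) : Matrix (Fin 2) (Fin 2) ℂ)‖ ≤ a₁))
    -- (b′) THE CORRECTOR ROWS (hK),(hK₂) per member, for every torus-potential letter `d` with its descent row and every characterised `(I, L)`
    (hKrows :
    ∀ (F : T3Family), F.L = L → ∀ (n K : ℕ) (hnK : n < K) (e : ℝ) (V : GaugeField (F.P n) 0 (Matrix.specialUnitaryGroup (Fin 2) ℂ))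
      (W : GaugeField (F.P K) 0 (Matrix.specialUnitaryGroup (Fin 2) ℂ)),
      0 < e → e ≤ e₆ → W ∈ regFibrePr F n K hnK.le e V → IsCritR2 F n K hnK.le V W →
      ∀ (d : Site (F.P K) 0 → ℕ), (∀ x : Site (F.P K) 0, x ∉ Set.range (embIter (K - n)) →
          ∃ μ : Fin (F.P K).d, d (torusT (F.P K) 0 μ x) + 1 ≤ d x ∨ d ((torusT (F.P K) 0 μ).symm x) + 1 ≤ d x) →
        ∀ (I : (Site (F.P K) 0 → Matrix (Fin 2) (Fin 2) ℂ) →+ (Site (F.P K) 0 → Matrix (Fin 2) (Fin 2) ℂ))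
        (L : (Fin (F.P K).d → Site (F.P K) 0 → Matrix (Fin 2) (Fin 2) ℂ) →+ (Site (F.P K) 0 → Matrix (Fin 2) (Fin 2) ℂ)),
        (∀ A φ, (∀ x, divB (torusT (F.P K) 0) (fun κ z => unitsField (toUField W) ⟨z, κ⟩)
        (fun μ => covD (torusT (F.P K) 0) (fun κ z => unitsField (toUField W) ⟨z, κ⟩) μ φ) x
        = divB (torusT (F.P K) 0) (fun κ z => unitsField (toUField W) ⟨z, κ⟩) A x) → L A = φ - I φ) →
        (∀ (A) (y : Site (F.P K) (K - n)), L A (embIter (K - n) y) = 0) →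
        (∀ φ, ∀ x : Site (F.P K) 0, x ∉ Set.range (embIter (K - n)) →
        divB (torusT (F.P K) 0) (fun κ z => unitsField (toUField W) ⟨z, κ⟩)
        (fun μ => covD (torusT (F.P K) 0) (fun κ z => unitsField (toUField W) ⟨z, κ⟩) μ
        (fun y => divB (torusT (F.P K) 0) (fun κ z => unitsField (toUField W) ⟨z, κ⟩)
        (fun ν => covD (torusT (F.P K) 0) (fun κ z => unitsField (toUField W) ⟨z, κ⟩) ν (I φ)) y)) x = 0) →
        (∀ (A) (μ : Fin (F.P K).d) (x : Site (F.P K) 0),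
        ‖covD (torusT (F.P K) 0) (fun κ z => unitsField (toUField W) ⟨z, κ⟩) μ (L A) x‖
        ≤ cI * (F.L : ℝ) ^ (K - n) * ‖(fun x => divB (torusT (F.P K) 0) (fun κ z => unitsField (toUField W) ⟨z, κ⟩) A x)‖) ∧
        (∀ A, ‖(fun x => ((min (d x : ℝ) ((F.L : ℝ) ^ (K - n)) : ℝ) : ℂ) •
        divB (torusT (F.P K) 0) (fun κ z => unitsField (toUField W) ⟨z, κ⟩)
        (fun μ y => (-Complex.I) • covD (torusT (F.P K) 0) (fun κ z => unitsField (toUField W) ⟨z, κ⟩) μ (L A) y) x)‖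
        ≤ c₂ * (F.L : ℝ) ^ (K - n) * ‖(fun x => divB (torusT (F.P K) 0) (fun κ z => unitsField (toUField W) ⟨z, κ⟩) A x)‖)) :
    (∀ (F : T3Family), F.L = L → ∀ (n K : ℕ) (hnK : n < K) (e : ℝ) (V : GaugeField (F.P n) 0 (Matrix.specialUnitaryGroup (Fin 2) ℂ))
      (W : GaugeField (F.P K) 0 (Matrix.specialUnitaryGroup (Fin 2) ℂ)),
      0 < e → e ≤ e₆ → W ∈ regFibrePr F n K hnK.le e V → IsCritR2 F n K hnK.le V W →
      ∀ W' : GaugeField (F.P K) 0 (Matrix.specialUnitaryGroup (Fin 2) ℂ), W' ∈ regFibrePr F n K hnK.le e V →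
        ∃ Y : GaugeField (F.P K) 0 (Matrix.specialUnitaryGroup (Fin 2) ℂ), Y ∈ regFibrePr F n K hnK.le e V ∧ wilsonAction4 W' = wilsonAction4 Y ∧
          (∀ b : PBond (F.P K) 0, ‖((Y b * (W b)⁻¹ : Matrix.specialUnitaryGroup (Fin 2) ℂ) : Matrix (Fin 2) (Fin 2) ℂ) - 1‖
            ≤ sQ * ((F.L : ℝ) ^ (K - n))⁻¹) ∧
          (∀ x : Site (F.P K) 0, x ∉ Set.range (embIter (K - n)) →
            divB (torusT (F.P K) 0) (fun κ z => unitsField (toUField W) ⟨z, κ⟩)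
              (fun μ z => covD (torusT (F.P K) 0) (fun κ z => unitsField (toUField W) ⟨z, κ⟩) μ
                (fun y => divB (torusT (F.P K) 0) (fun κ z => unitsField (toUField W) ⟨z, κ⟩)
                  (fun κ z => Complex.I • ((-Complex.I) • mlog ((Y ⟨z, κ⟩ * (W ⟨z, κ⟩)⁻¹ : Matrix.specialUnitaryGroup (Fin 2) ℂ) : Matrix (Fin 2) (Fin 2) ℂ))) y) z) x = 0)) := by
  intro F hF n K hnK e V W he hee hW hcrit W' hW'
  obtain ⟨A₀, u, Fr, a₀, a₁, hW'eq, hA0, hs₀, hs₁, hσ, hFr, hFr1, ha₀, ha₁, hc₀, hc₁, hA⟩ :=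
    hDatum F hF n K hnK e V W he hee hW hcrit W' hW'
  subst hW'eq
  subst hsQ
  have hk1 : 1 ≤ K - n := by omega
  have hs40' : 40 * s ≤ (F.L : ℝ) ^ (K - n) := by
    rw [hF]
    exact forty_mul_le_pow (le_of_lt (hF ▸ F.hL.2)) hk1 hs40
  have hd : ((F.P K).d : ℝ) = 3 := by rw [T3Family.P_d]; norm_num
  have hS₂' : (s₁' + ((F.P K).d : ℝ) * (((2 * (c₁ + 2 * c₀ ^ 2) + 24 * c₀ + 24) * (2 * σ)) + 9 * ((6 + 2 * c₀) * (2 * σ)) ^ 2 + 36 * σ * ((2 * (c₁ + 2 * c₀ ^ 2) + 24 * c₀ + 24) * (2 * σ))) + ((F.P K).d : ℝ) * (6 * ((6 + 2 * c₀) * (2 * σ)) * s₀ + 4 * s₀ * ((1 + 6 * σ) * ((6 + 2 * c₀) * (2 * σ))))) ≤ s := by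
    rw [hd]; exact hS₂
  obtain ⟨d, -, -, hdesc⟩ := exists_torusPotential (P := F.P K) (K - n)
  exact pinnedSlice_of_untwistedStart F hnK.le hk1 he.le W A₀ hA0 hs₀ hs₀' hs₁ u hW' hσ hσ0 hσc Fr hFr hFr1 ha₀ ha₁ hc₀ hc₁ hA
    d hdesc hcI hc₂ (hKrows F hF n K hnK e V W he hee hW hcrit d hdesc) hS₁ hS₂' hs40' hwin1 hwin2

end Summit.QuantumFields.YangMills.Theorems.Prop7PinnedSliceRowOfThm2Datum

end
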